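import Summits.NavierStokesRegularity.NavierStokesRegularity.Theorems.TypeILiouvilleTypeIliouvilleNoTypeIITypeIIZoomLiouvilleModL
import Summits.NavierStokesRegularity.NavierStokesRegularity.Theorems.TypeILiouvilleTypeIliouvilleNoTypeIIEternalSplitPressureFree
import Summits.NavierStokesRegularity.NavierStokesRegularity.Theorems.TypeILiouvilleLKillsTypeI
import HarnessLib

/-!
# The eternal-split of `NoTypeII` modulo (L): `NoTypeII ⇐ S₁′ ∧ (L)` and `Clay (A) ⇐ S₁′ ∧ (L)`
# (crux `TypeIliouvilleNoTypeII`, stmt-NavierStokesRegularity-0056; hard core (L) = `TypeIliouvilleL`,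
# stmt-NavierStokesRegularity-10661)

Helper file (theorems only).  ns-typeII-p1's `…EternalSplitPressureFree.lean` closes the hard core
`NoTypeII` in the kernel MODULO two open statements: the pressure-free energy-Type-I slab clause
S₁′ (for every maximal Leray–Hopf solution from rapidly decaying data, Albritton–Barker's `A`, `C`,
`E` of the viscosity-normalised field are bounded by a finite `I` on every parabolic ball of a final
slab) and the pressure-free eternal energy Liouville statement EEL′ (a bounded eternal Oseen-mild
smooth divergence-free `v`, `‖v‖ ≤ 2`, with `A`, `C`, `E` finite-bounded on all balls has
`v(0,0) = 0`).  This file DISCHARGES EEL′ FROM (L) — KNSS's Liouville conjecture, the route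
`TypeILiouville`'s own crux `TypeIliouvilleL` — using only the `A`-clause: (L) makes every slice of
`v` constant (`stub_eternalLiouville_of_liouvilleConjecture`), the constants `c(t) = v(t, 0)` depend
continuously on `t`, and `A_ess(v; Q_r(t + r²/2, 0)) ≥ ‖c(t)‖² |B₁| r²` (a continuous function is
below its essential supremum on an open interval), unbounded in `r` unless `c(t) = 0`.

* `le_essSup_Ioo_of_continuous` — `g(t) ≤ ess sup_{(a,b)} g` for continuous `g`, `t ∈ (a, b)`;
* `enorm_sq_mul_le_cknAEss_of_const`, `slice_eq_zero_of_const_of_cknAEss_le`,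
  `eternal_eq_zero_of_liouvilleL_of_cknAEss_le` — the `ess sup` twins of the `cknA` lemmas of
  `…TypeIIZoomLiouvilleModL.lean`;
* `eternalLiouvillePressureFree_of_liouvilleL` — **(L) ⇒ EEL′**, in EXACTLY the hypothesis shape of
  p1's `typeIliouvilleNoTypeII_of_pressureFreeSlab_of_eternalLiouville`;
* `typeIliouvilleNoTypeII_of_pressureFreeSlab_of_liouvilleL` — **`NoTypeII ⇐ S₁′ ∧ (L)`** by name;
* `navierStokesRegularity_of_pressureFreeSlab_of_liouvilleL` — **`Clay (A) ⇐ S₁′ ∧ (L)`**: through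
  the route's deciding theorem `TypeILiouville.closes`, its proved items `Assembly_holds` and
  `typeILiouville_typeIliouvilleLKillsTypeI_proof`.  For the route `TypeILiouville` the Type-II
  residual is thereby RELOCATED from the pointwise rate (C3) to the `A, C, E`-slab bound (the
  pressure-free part of Albritton–Barker's C1′).

WHAT THIS IS NOT: not NS regularity — S₁′ and (L) are OPEN; implications between open statements.
-/

noncomputable section

-- the summit and its single problem share the name `NavierStokesRegularity` (D-0017 nested layout)
set_option linter.dupNamespace false

open Set Function Filter Topology MeasureTheory Metric
open scoped NNReal ENNReal

namespace Summit.NavierStokesRegularity.NavierStokesRegularity.Theorems.TypeIliouvilleNoTypeII.TypeIIZoom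

open Literature.Analysis Literature.Analysis.FluidPDE
open Summit.NavierStokesRegularity.NavierStokesRegularity.Theorems.TypeIliouvilleNoTypeII.ImmortalZoom
open Summit.NavierStokesRegularity.NavierStokesRegularity.Theorems.TypeIliouvilleNoTypeII.EternalSplit
open Summit.NavierStokesRegularity.NavierStokesRegularity.Theses.TypeILiouville (TypeIliouvilleL
  TypeIliouvilleNoTypeII TypeIliouvilleLKillsTypeI Assembly Assembly_holds closes)

variable {v : ℝ → EuclideanSpace ℝ (Fin 3) → EuclideanSpace ℝ (Fin 3)}

/-! ## A continuous function lies below its essential supremum on an open interval -/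

/-- For a continuous `g : ℝ → [0, ∞]` and `t ∈ (a, b)`: `g(t) ≤ ess sup_{(a,b)} g` (the open set
`{g > ess sup} ∩ (a, b)` has measure zero, hence is empty). [folklore] -/
theorem le_essSup_Ioo_of_continuous {g : ℝ → ℝ≥0∞} (hg : Continuous g) {a b t : ℝ}
    (ht : t ∈ Ioo a b) : g t ≤ essSup g (volume.restrict (Ioo a b)) := by
  by_contra hlt
  rw [not_le] at hlt
  set m := essSup g (volume.restrict (Ioo a b)) with hm
  have hU : IsOpen ({s | m < g s} ∩ Ioo a b) := (isOpen_lt continuous_const hg).inter isOpen_Ioo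
  have hne : ({s | m < g s} ∩ Ioo a b).Nonempty := ⟨t, hlt, ht⟩
  have hpos : 0 < volume ({s | m < g s} ∩ Ioo a b) := hU.measure_pos volume hne
  have hae : ∀ᵐ s ∂(volume.restrict (Ioo a b)), g s ≤ m := ENNReal.ae_le_essSup g
  have hzero : volume.restrict (Ioo a b) {s | m < g s} = 0 := by
    rw [ae_iff] at hae
    simpa only [not_le] using hae
  rw [Measure.restrict_apply (isOpen_lt continuous_const hg).measurableSet] at hzero
  exact hpos.ne' hzero

/-! ## Constant slices and the `ess sup` scaled local energy -/

/-- **The `ess sup` scaled local energy of a field with constant slices**: if `v(s, ·) ≡ v(s, 0)`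
for all `s`, `s ↦ v(s, 0)` is continuous and `r > 0`, then
`‖v(t,0)‖² · |B₁| · r² ≤ A_ess(v; Q_r(t + r²/2, 0))`. [folklore] -/
theorem enorm_sq_mul_le_cknAEss_of_const (hcont : Continuous fun s => v s 0)
    (hconst : ∀ s x, v s x = v s 0) {r : ℝ} (hr : 0 < r) (t : ℝ) :
    ‖v t 0‖ₑ ^ (2 : ℕ) * volume (ball (0 : EuclideanSpace ℝ (Fin 3)) 1) * ENNReal.ofReal (r ^ 2) ≤
      cknAEss r ((t + r ^ 2 / 2, 0) : ℝ × EuclideanSpace ℝ (Fin 3)) v := by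
  set z : ℝ × EuclideanSpace ℝ (Fin 3) := (t + r ^ 2 / 2, 0) with hz
  have hr2 : 0 < r ^ 2 := by positivity
  have ht : t ∈ Ioo (z.1 - r ^ 2) z.1 := ⟨by simp only [hz]; linarith, by simp only [hz]; linarith⟩
  -- the slice energies as a continuous function of time
  have h3 : volume (ball (0 : EuclideanSpace ℝ (Fin 3)) r) =
      ENNReal.ofReal (r ^ 3) * volume (ball (0 : EuclideanSpace ℝ (Fin 3)) 1) := by
    rw [Measure.addHaar_ball_of_pos volume 0 hr, finrank_euclideanSpace_fin]
  have hG : (fun s => (ENNReal.ofReal r)⁻¹ * ∫⁻ y in ball z.2 r, ‖v s y‖ₑ ^ 2) =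
      fun s => (ENNReal.ofReal r)⁻¹ * volume (ball (0 : EuclideanSpace ℝ (Fin 3)) r) *
        ‖v s 0‖ₑ ^ (2 : ℕ) := by
    funext s
    have hf : (fun y => ‖v s y‖ₑ ^ 2) = fun _ => ‖v s 0‖ₑ ^ (2 : ℕ) :=
      funext fun y => by rw [hconst s y]
    rw [hf, setLIntegral_const]
    simp only [hz]
    ring
  have hK : (ENNReal.ofReal r)⁻¹ * volume (ball (0 : EuclideanSpace ℝ (Fin 3)) r) ≠ ⊤ :=
    ENNReal.mul_ne_top (ENNReal.inv_ne_top.2 (by simpa using hr)) measure_ball_lt_top.ne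
  have hGc : Continuous fun s =>
      (ENNReal.ofReal r)⁻¹ * volume (ball (0 : EuclideanSpace ℝ (Fin 3)) r) * ‖v s 0‖ₑ ^ (2 : ℕ) :=
    (ENNReal.continuous_const_mul hK).comp
      ((ENNReal.continuous_pow 2).comp (continuous_enorm.comp hcont))
  have hle := le_essSup_Ioo_of_continuous hGc ht
  unfold cknAEss
  rw [hG]
  refine le_trans (le_of_eq ?_) hle
  rw [h3, ← inv_ofReal_mul_ofReal_pow_three hr]
  ring

/-- **Constant slices with uniformly bounded `ess sup` scaled local energy vanish.**  If every slice
of `v` is constant, `s ↦ v(s, 0)` is continuous, and `A_ess(v; Q_r(z)) ≤ I ≠ ∞` for every parabolic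
ball, then `v ≡ 0`. [folklore] -/
theorem slice_eq_zero_of_const_of_cknAEss_le (hcont : Continuous fun s => v s 0)
    (hconst : ∀ s x, v s x = v s 0) {I : ℝ≥0∞} (hI : I ≠ ⊤)
    (hA : ∀ r : ℝ, 0 < r → ∀ z : ℝ × EuclideanSpace ℝ (Fin 3), cknAEss r z v ≤ I)
    (t : ℝ) (x : EuclideanSpace ℝ (Fin 3)) : v t x = 0 := by
  rw [hconst t x]
  by_contra hv0
  set a : ℝ≥0∞ := ‖v t 0‖ₑ ^ (2 : ℕ) * volume (ball (0 : EuclideanSpace ℝ (Fin 3)) 1) with ha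
  have ha0 : a ≠ 0 :=
    mul_ne_zero (pow_ne_zero _ (enorm_ne_zero.2 hv0)) (measure_ball_pos volume 0 one_pos).ne'
  have key : ∀ r : ℝ, 0 < r → a * ENNReal.ofReal (r ^ 2) ≤ I := fun r hr =>
    (enorm_sq_mul_le_cknAEss_of_const hcont hconst hr t).trans (hA r hr _)
  have hlim : Tendsto (fun r : ℝ => a * ENNReal.ofReal (r ^ 2)) atTop (𝓝 ⊤) := by
    have h : Tendsto (fun r : ℝ => ENNReal.ofReal (r ^ 2)) atTop (𝓝 ⊤) :=
      ENNReal.tendsto_ofReal_atTop.comp (tendsto_pow_atTop two_ne_zero)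
    have h' : Tendsto (fun r : ℝ => a * ENNReal.ofReal (r ^ 2)) atTop (𝓝 (a * ⊤)) :=
      ENNReal.Tendsto.const_mul h (Or.inl ENNReal.top_ne_zero)
    rwa [ENNReal.mul_top ha0] at h'
  obtain ⟨r, hIr, hr⟩ :=
    ((hlim.eventually_const_lt hI.lt_top).and (eventually_gt_atTop 0)).exists
  exact lt_irrefl I (hIr.trans_le (key r hr))

/-- **RIGIDITY MODULO (L), `ess sup` form.**  Under `TypeIliouvilleL`, a bounded eternal Oseen-mild
smooth divergence-free field whose `ess sup` scaled local energy `A_ess` is bounded by some `I ≠ ∞`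
on all parabolic balls vanishes identically. [cite: KochNadirashviliSereginSverak2009, §1 conjecture (L) and §6 Prop. 6.1 (arXiv:0709.3599)] -/
theorem eternal_eq_zero_of_liouvilleL_of_cknAEss_le (hL : TypeIliouvilleL)
    (v : ℝ → EuclideanSpace ℝ (Fin 3) → EuclideanSpace ℝ (Fin 3))
    (hv : ContDiff ℝ (⊤ : ℕ∞) (uncurry v)) (hdiv : ∀ t, VectorCalculus.IsDivFree (v t))
    (hmild : ∀ s t : ℝ, s < t → ∀ x, v t x = heatFlow (v s) (t - s) x - oseenDuhamel 1 s v v t x)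
    (hbdd : ∃ C : ℝ, ∀ t x, ‖v t x‖ ≤ C) {I : ℝ≥0∞} (hI : I ≠ ⊤)
    (hA : ∀ r : ℝ, 0 < r → ∀ z : ℝ × EuclideanSpace ℝ (Fin 3), cknAEss r z v ≤ I) :
    ∀ t x, v t x = 0 := by
  have h0 := stub_eternalLiouville_of_liouvilleConjecture hL v hv hdiv hmild hbdd
  have hconst : ∀ s x, v s x = v s 0 := fun s => slice_const_of_fderiv_eq_zero hv (h0 s)
  have hcont : Continuous fun s => v s 0 :=
    hv.continuous.comp (continuous_id.prodMk continuous_const)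
  exact slice_eq_zero_of_const_of_cknAEss_le hcont hconst hI hA

/-! ## (L) ⇒ EEL′, and the eternal split modulo (L) -/

/-- **(L) ⇒ EEL′** — KNSS's Liouville conjecture implies the pressure-free eternal energy Liouville
statement, in exactly the hypothesis shape consumed by
`EternalSplit.typeIliouvilleNoTypeII_of_pressureFreeSlab_of_eternalLiouville` (only the `A_ess`-clause
is used; the `C`- and `E`-clauses are discarded). [cite: KochNadirashviliSereginSverak2009, §1 conjecture (L) (arXiv:0709.3599 p. 3)] -/
theorem eternalLiouvillePressureFree_of_liouvilleL (hL : TypeIliouvilleL)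
    (v : ℝ → EuclideanSpace ℝ (Fin 3) → EuclideanSpace ℝ (Fin 3))
    (hv : ContDiff ℝ (⊤ : ℕ∞) (uncurry v)) (hdiv : ∀ t, VectorCalculus.IsDivFree (v t))
    (hmild : ∀ s t : ℝ, s < t → ∀ x, v t x = heatFlow (v s) (t - s) x - oseenDuhamel 1 s v v t x)
    (hbd : ∀ t x, ‖v t x‖ ≤ 2)
    (hI : ∃ I : ℝ≥0∞, I ≠ ⊤ ∧ ∀ r : ℝ, 0 < r → ∀ z : ℝ × EuclideanSpace ℝ (Fin 3),
      cknAEss r z v ≤ I ∧ cknC r z v ≤ I ∧ cknE r z (fun s y => fderiv ℝ (v s) y) ≤ I) :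
    v 0 0 = 0 := by
  obtain ⟨I, hItop, hball⟩ := hI
  exact eternal_eq_zero_of_liouvilleL_of_cknAEss_le hL v hv hdiv hmild ⟨2, hbd⟩ hItop
    (fun r hr z => (hball r hr z).1) 0 0

/-- **`NoTypeII ⇐ S₁′ ∧ (L)`, BY NAME.**  If every maximal Leray–Hopf solution from a rapidly
decaying datum satisfies the pressure-free energy-Type-I slab clause S₁′ (Albritton–Barker's `A`,
`C`, `E` of the viscosity-normalised field `timeRescale ν⁻¹ ν⁻¹ u` bounded by a finite `I` on every
parabolic ball of a final slab `(S₁, νT) × ℝ³`), and KNSS's Liouville conjecture (L) holds, then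
`TypeIliouvilleNoTypeII` (stmt-NavierStokesRegularity-0056). [cite: KochNadirashviliSereginSverak2009, §1 conjecture (L) and §6 (arXiv:0709.3599)] -/
theorem typeIliouvilleNoTypeII_of_pressureFreeSlab_of_liouvilleL
    (hS : ∀ (ν T : ℝ), 0 < ν → 0 < T →
      ∀ (u : ℝ → EuclideanSpace ℝ (Fin 3) → EuclideanSpace ℝ (Fin 3))
        (p : ℝ → EuclideanSpace ℝ (Fin 3) → ℝ),
      IsMaximalSmoothSolution ν 0 u p T → IsLerayHopfOn T ν 0 (u 0) u → HasRapidSpatialDecay (u 0) →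
      ∃ S₁ : ℝ, S₁ < ν * T ∧ ∃ I : ℝ≥0∞, I ≠ ⊤ ∧
        (∀ r : ℝ, 0 < r → ∀ z : ℝ × EuclideanSpace ℝ (Fin 3),
          parabolicCylinder r z ⊆ Ioo S₁ (ν * T) ×ˢ univ →
          cknAEss r z (timeRescale ν⁻¹ ν⁻¹ u) ≤ I ∧ cknC r z (timeRescale ν⁻¹ ν⁻¹ u) ≤ I ∧
          cknE r z (fun s y => fderiv ℝ (timeRescale ν⁻¹ ν⁻¹ u s) y) ≤ I))
    (hL : TypeIliouvilleL) : TypeIliouvilleNoTypeII :=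
  typeIliouvilleNoTypeII_of_pressureFreeSlab_of_eternalLiouville hS
    (eternalLiouvillePressureFree_of_liouvilleL hL)

/-- **`Clay (A) ⇐ S₁′ ∧ (L)`.**  Feeding `NoTypeII ⇐ S₁′ ∧ (L)` into the deciding theorem of route
`TypeILiouville` (`closes : NoTypeII → (L) → LKillsTypeI → Assembly → NavierStokesRegularity`, with
`LKillsTypeI` and `Assembly` PROVED items): the pressure-free energy-Type-I slab clause together with
KNSS's Liouville conjecture gives the Clay Millennium statement (A).  Both hypotheses are OPEN; this
is a relocation of the route's Type-II residual, not a regularity claim. [cite: KochNadirashviliSereginSverak2009, §1 and §6 Prop. 6.1 (arXiv:0709.3599)] -/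
theorem navierStokesRegularity_of_pressureFreeSlab_of_liouvilleL
    (hS : ∀ (ν T : ℝ), 0 < ν → 0 < T →
      ∀ (u : ℝ → EuclideanSpace ℝ (Fin 3) → EuclideanSpace ℝ (Fin 3))
        (p : ℝ → EuclideanSpace ℝ (Fin 3) → ℝ),
      IsMaximalSmoothSolution ν 0 u p T → IsLerayHopfOn T ν 0 (u 0) u → HasRapidSpatialDecay (u 0) →
      ∃ S₁ : ℝ, S₁ < ν * T ∧ ∃ I : ℝ≥0∞, I ≠ ⊤ ∧
        (∀ r : ℝ, 0 < r → ∀ z : ℝ × EuclideanSpace ℝ (Fin 3),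
          parabolicCylinder r z ⊆ Ioo S₁ (ν * T) ×ˢ univ →
          cknAEss r z (timeRescale ν⁻¹ ν⁻¹ u) ≤ I ∧ cknC r z (timeRescale ν⁻¹ ν⁻¹ u) ≤ I ∧
          cknE r z (fun s y => fderiv ℝ (timeRescale ν⁻¹ ν⁻¹ u s) y) ≤ I))
    (hL : TypeIliouvilleL) : _root_.NavierStokesRegularity :=
  closes (typeIliouvilleNoTypeII_of_pressureFreeSlab_of_liouvilleL hS hL) hL
    typeILiouville_typeIliouvilleLKillsTypeI_proof Assembly_holds

end Summit.NavierStokesRegularity.NavierStokesRegularity.Theorems.TypeIliouvilleNoTypeII.TypeIIZoom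

end
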